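import Summits.CriticalPhenomena.PercolationContinuityZ3.Theorems.PercNearOneGluingNoHeavyQuantGatedSliceMixLawQMidsAbsorb
import Summits.CriticalPhenomena.PercolationContinuityZ3.Theorems.PercNearOneGluingNoHeavyQuantGatedSliceMixLawQTwinOpenIneq
import Summits.CriticalPhenomena.PercolationContinuityZ3.Theorems.PercNearOneGluingNoHeavyQuantGatedSliceMixLawQLightTop
import Summits.CriticalPhenomena.PercolationContinuityZ3.Theorems.PercNearOneGluingNoHeavyQuantLawDecUsageMonge
import HarnessLib

/-!
# QUANT lane R8, T-DEC, leg (III), blob case — `LawDec.GatedSliceMixLaw'`, the Q-ALONE side in REGIME R: the TWIN-ABOVE-`t` classes (`Mm`, `MM`):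
# twin `P = k₁ + a > t` (a mid open to the zero and to `k₁`), top `k₂ ≤ j` a mid (closed, heavy or light for `k₁`), `k₂ + a` a giant ⟹ `Q` is DEC

builds on p205010 (kernel theorem, internal audit signed; external expert review pending)

Support file (`--supports stmt-CriticalPhenomena-4575`), QUANT lane seat prim-quant-arm-1 (gen 41), rung R8 of
`run/shared/lean/prim/quant/LADDER.md`.  Theorems only, standard axioms, no sorries, no definitions.  Uses `…QRouting`, `…QMidsAbsorb`, the scalar lemmas of
`…QTwinOpenIneq` (`twinOpen_I2_open/_I2_closed/_beta_open/_beta_closed` — none of them uses `P ≤ t`) and of `…QLightIneq`/`…QLightTop`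
(`mixLawQ_offer_of_surplus`, `mixLawQ_light_gate`, `mixLawQ_surplus_light_ge`).  Memo `run/shared/lean/prim/quant/prim-quant-arm-1-g41/Q-ALONE-G41.md` §4b.

THE CELL.  Frame of the node; `1 ≤ k₁ ≤ j`, `2k₁ < t`, twin `P = k₁ + a ≤ j` with `t < P` (hence open to `k₁`), top `K = k₂ ≤ j`, `t ≤ 2K`, `G = k₂ + a ≥ j+1`.
Then `Q` is `DECAtT y t j (M+a)` (`mixLawQ_decAtT_twinAbove`).  ROUTING (`W = t − 2k₁ < a`): `W ≤ ag` ⟹ the twin absorbs `k₁` (`…of_midsAbsorb`); else the twin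
is heavy and saturated and `2k₁ ≤ S`; the top is closed (`k₁ + K ≤ t`: `twinOpen_beta_closed` with I2c), or open and either absorbs the rest (`…of_midsAbsorb`)
or is saturated — heavy: `twinOpen_beta_open` with I2o; light: `mixLawQ_offer_of_surplus` with `S_P = k₁B(2P−t)/W ≥ 0` and `S_K ≥ k₁A` (`mixLawQ_light_gate`).
EXACT CENSUS (`work/explore/qMM.py`, `qlight4.py`): I2c universal in Mm (14 497 / 0), I2o universal in Mm/MM heavy (94 968 / 0), light gate universal (MM 8 696 / 0).
With `…QTwinClosed/…QTwinOpen/…QTopOpen/…QLightTop` this completes the classes `{m,M}×{m,M}` of cell Q4 (`k₁ ≥ 1`, top a mid, `k₂ + a` a giant).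
HONEST STATUS: the k₂-low classes (cell QK), cell QH and the assembly of `MixLawCellQ4` remain; `GatedSliceMixLaw'` (regime R), CW, `GateMove`,
`GatedConvEmptyFree`, `SingleGateConvClosed`, `TreeDEC`, `FarTreeRow` OPEN; RATE class log\* / honest sentence unchanged.

* **`LawDec.mixLawQ_decAtT_twinAbove`**, `LawDec.gatedSliceMixLaw'_twinAbove`.

[this work]; node: prim-quant-stmt g29/g30 (this lane).  Nothing here is cited as a published result.  The gluing rows served
[cite: KozmaNitzan2024, Conjecture 3 (p. 15)]; product measure [cite: Grimmett1999, §1.3 p. 10].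
-/

noncomputable section

namespace Summit.CriticalPhenomena.PercolationContinuityZ3.Theorems

namespace Quant

open Finset

/-- the two-point law `{lo, hi; g}` (as in `…QuantLawDEC`) -/
local notation3 "TP[" lo ", " hi ", " g ", " h "]" =>
  (g : ℝ) * (if (h : ℕ) = (hi : ℕ) then (1 : ℝ) else 0) + (1 - (g : ℝ)) * (if (h : ℕ) = (lo : ℕ) then (1 : ℝ) else 0)

namespace LawDec

set_option maxHeartbeats 800000 in
/-- **TWIN ABOVE `t` (classes `Mm`, `MM`) ⟹ `Q` IS DEC.**  See the file header. [this work] -/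
theorem mixLawQ_decAtT_twinAbove (y z g S lam : ℝ) (a j M k₁ k₂ : ℕ)
    (hy0 : 0 < y) (hy1 : y < 1) (hz0 : 0 ≤ z) (hz1 : z < 1) (hg1 : g ≤ 1) (hyg : y ≤ (1 - z) * g) (ha : 1 ≤ a)
    (hta : y * (M : ℝ) ≤ S) (hk : k₁ ≤ k₂) (hk₂M : k₂ ≤ M) (hlam0 : 0 ≤ lam) (hlam1 : lam ≤ 1)
    (hmean : (1 - z) * ((k₁ : ℝ) + ((k₂ : ℝ) - k₁) * lam) = S)
    (hk₁ : 1 ≤ k₁) (hk₁j : k₁ ≤ j) (hk₁low : 2 * (k₁ : ℝ) < S + (a : ℝ) * g * (1 - z))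
    (hPj : k₁ + a ≤ j) (hPopen : S + (a : ℝ) * g * (1 - z) < (k₁ : ℝ) + a)
    (hKj : k₂ ≤ j) (hKmid : S + (a : ℝ) * g * (1 - z) ≤ 2 * (k₂ : ℝ))
    (hG : j + 1 ≤ k₂ + a) :
    DECAtT y (S + (a : ℝ) * g * (1 - z)) j (M + a)
      (fun p => z * (if p = 0 then (1 : ℝ) else 0) + (1 - z) * slice (fun q => TP[k₁, k₂, lam, q]) a g p) := by
  set t : ℝ := S + (a : ℝ) * g * (1 - z) with ht
  set A : ℝ := (1 - z) * (1 - lam) * (1 - g) with hA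
  set B : ℝ := (1 - z) * (1 - lam) * g with hB
  set C : ℝ := (1 - z) * lam * (1 - g) with hC
  set D : ℝ := (1 - z) * lam * g with hD
  have hg0 : 0 < g := by
    by_contra hc
    have : (1 - z) * g ≤ 0 := mul_nonpos_of_nonneg_of_nonpos (by linarith) (not_lt.1 hc)
    linarith
  have h1z : 0 < 1 - z := by linarith
  have h1y : 0 < 1 - y := by linarith
  have hA0 : 0 ≤ A := mul_nonneg (mul_nonneg h1z.le (by linarith)) (by linarith)
  have hB0 : 0 ≤ B := mul_nonneg (mul_nonneg h1z.le (by linarith)) hg0.le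
  have hC0 : 0 ≤ C := mul_nonneg (mul_nonneg h1z.le hlam0) (by linarith)
  have hD0 : 0 ≤ D := mul_nonneg (mul_nonneg h1z.le hlam0) hg0.le
  have ha1 : (1 : ℝ) ≤ a := by exact_mod_cast ha
  have hk₁r : (1 : ℝ) ≤ k₁ := by exact_mod_cast hk₁
  have hkr : (k₁ : ℝ) ≤ k₂ := by exact_mod_cast hk
  have ht0 : 0 < t := by linarith
  have hPr : ((k₁ + a : ℕ) : ℝ) = (k₁ : ℝ) + a := by push_cast; ring
  have hk₁k₂ : (k₁ : ℝ) < k₂ := by linarith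
  have hPmid' : t ≤ 2 * ((k₁ + a : ℕ) : ℝ) := by rw [hPr]; linarith
  -- mass and mean (pure algebra)
  have hmass : z + A + B + C + D = 1 := by rw [hA, hB, hC, hD]; ring
  have hmom : (k₁ : ℝ) * A + ((k₁ : ℝ) + a) * B + (k₂ : ℝ) * C + ((k₂ : ℝ) + a) * D = t := by
    rw [hA, hB, hC, hD, ht, ← hmean]; ring
  have htz : t * z = -((t - k₁) * A) - (t - ((k₁ : ℝ) + a)) * B - (t - k₂) * C + ((k₂ : ℝ) + a - t) * D := by
    have e1 : t * z = t * (1 - A - B - C - D) := by rw [← hmass]; ring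
    rw [e1]; linarith [hmom]
  have hyK : y * (k₂ : ℝ) ≤ S := (mul_le_mul_of_nonneg_left (by exact_mod_cast hk₂M) hy0.le).trans hta
  have hyG : y * ((k₂ : ℝ) + a) ≤ t := by
    have h3 : y * (a : ℝ) ≤ (a : ℝ) * g * (1 - z) := by
      calc y * (a : ℝ) ≤ (1 - z) * g * (a : ℝ) := mul_le_mul_of_nonneg_right hyg (Nat.cast_nonneg a)
        _ = (a : ℝ) * g * (1 - z) := by ring
    have e : y * ((k₂ : ℝ) + a) = y * (k₂ : ℝ) + y * (a : ℝ) := by ring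
    rw [e, ht]; linarith
  have huG : usage y t j k₁ (k₂ + a) = y / (1 - y) := usage_giant_eq y t j k₁ (k₂ + a) hG
  have hcapG_of : ∀ xG : ℝ, y * (z + xG) ≤ (1 - y) * D → usage y t j k₁ (k₂ + a) * xG ≤ D := by
    intro xG hE
    rw [huG, div_mul_eq_mul_div, div_le_iff₀ h1y]
    have : y * xG ≤ y * (z + xG) := by nlinarith
    linarith [mul_comm (1 - y) D]
  have hfinal : ∀ xG : ℝ, y * (z + xG) ≤ (1 - y) * D →
      t * z ≤ t * (1 - y) / y * (D - usage y t j k₁ (k₂ + a) * xG) := by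
    intro xG hE
    rw [huG]
    have hz : z ≤ (1 - y) / y * D - xG := by
      rw [div_mul_eq_mul_div, le_sub_iff_add_le, le_div_iff₀ hy0]
      linarith [hE, mul_comm y (z + xG)]
    have e : t * (1 - y) / y * (D - y / (1 - y) * xG) = t * ((1 - y) / y * D - xG) := by
      have hy0' : y ≠ 0 := ne_of_gt hy0
      have h1y' : 1 - y ≠ 0 := ne_of_gt h1y
      field_simp
    rw [e]
    exact mul_le_mul_of_nonneg_left hz ht0.le
  have hKng : ¬ (j + 1 ≤ k₂) := by omega
  have hPng : ¬ (j + 1 ≤ k₁ + a) := by omega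
  have hPabs : t ≤ 2 * ((k₁ + a : ℕ) : ℝ) ∨ j < k₁ + a := Or.inl hPmid'
  have hKabs : t ≤ 2 * (k₂ : ℝ) ∨ j < k₂ := Or.inl hKmid
  -- the twin: open to `k₁`, rate `W/a`
  set W : ℝ := t - 2 * (k₁ : ℝ) with hWdef
  have hW0 : 0 < W := by rw [hWdef]; linarith
  have ha0 : (0 : ℝ) < a := by linarith
  have hWa : W < a := by rw [hWdef]; linarith
  have hPcomp : t < (k₁ : ℝ) + ((k₁ + a : ℕ) : ℝ) := by rw [hPr]; linarith
  have hρP : (t - 2 * (k₁ : ℝ)) / (((k₁ + a : ℕ) : ℝ) - k₁) = W / a := by rw [hPr, hWdef]; ring_nf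
  have hyg' : y ≤ g := by
    have := mul_le_of_le_one_left hg0.le (show 1 - z ≤ 1 by linarith)
    linarith
  have hd : (0 : ℝ) < (k₂ : ℝ) - k₁ := by linarith
  have eAB : (1 - z) * ((1 - lam) * ((t - 2 * (k₁ : ℝ)) - 2 * (a : ℝ) * g)) = A * W - B * (2 * ((k₁ : ℝ) + a) - t) := by
    rw [hA, hB, hWdef]; ring
  by_cases hWg : W ≤ (a : ℝ) * g
  · -- the twin absorbs `k₁` entirely
    have hpg : pairGate y t k₁ (k₁ + a) ≤ g := by
      simp only [pairGate]
      rw [hρP]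
      have h1 : W / a ≤ g := by rw [div_le_iff₀ ha0]; linarith
      refine max_le h1 ?_
      have h2 : (1 - y) * (W / a) ≤ (1 - y) * g := mul_le_mul_of_nonneg_left h1 h1y.le
      have h3 : y ^ 2 ≤ y * g := by rw [sq]; exact mul_le_mul_of_nonneg_left hyg' hy0.le
      linarith
    have hpg1 : pairGate y t k₁ (k₁ + a) < 1 := pairGate_lt_one y t k₁ (k₁ + a) hy0 hy1 hk₁low hPcomp
    have huse : usage y t j k₁ (k₁ + a) * A ≤ B := by
      have eU : usage y t j k₁ (k₁ + a) = pairGate y t k₁ (k₁ + a) / (1 - pairGate y t k₁ (k₁ + a)) := by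
        simp only [usage, gateOf, if_neg hPng]
      rw [eU, div_mul_eq_mul_div, div_le_iff₀ (by linarith)]
      rw [hA, hB]
      have h1g : 0 ≤ (1 - z) * (1 - lam) := mul_nonneg h1z.le (by linarith)
      have h := mul_le_mul_of_nonneg_left hpg h1g
      have e1 : pairGate y t k₁ (k₁ + a) * ((1 - z) * (1 - lam) * (1 - g))
          = (1 - z) * (1 - lam) * pairGate y t k₁ (k₁ + a) - ((1 - z) * (1 - lam) * pairGate y t k₁ (k₁ + a)) * g := by ring
      have e2 : (1 - z) * (1 - lam) * g * (1 - pairGate y t k₁ (k₁ + a))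
          = (1 - z) * (1 - lam) * g - ((1 - z) * (1 - lam) * pairGate y t k₁ (k₁ + a)) * g := by ring
      rw [e1, e2]
      linarith [h]
    exact mixLawQ_decAtT_of_midsAbsorb y z g S lam a j M k₁ k₂ A 0 hy0 hy1 hz0 hz1 hg1 hyg ha hta hk hk₂M hlam0 hlam1 hmean
      hk₁ hk₁j hk₁low hPabs hKabs hG hA0 le_rfl (by ring) (fun _ => ⟨hPj, hPcomp⟩) (fun h => absurd h (lt_irrefl _))
      huse (by rw [mul_zero]; exact hC0)
  · -- the twin is heavy and saturated; `2k₁ ≤ S`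
    have hWg' : (a : ℝ) * g < W := not_le.1 hWg
    have h2k : 2 * (k₁ : ℝ) ≤ S := by
      have h0 : 0 ≤ (a : ℝ) * g * z := mul_nonneg (mul_nonneg ha0.le hg0.le) hz0
      have h1 : (a : ℝ) * g < t - 2 * (k₁ : ℝ) := hWg'
      have e : (a : ℝ) * g * (1 - z) = a * g - a * g * z := by ring
      linarith [h1, ht, e, h0]
    have hρP1 : W / a < 1 := by rw [div_lt_one ha0]; exact hWa
    have hρP0 : 0 < W / a := div_pos hW0 ha0
    have hyρP : y ≤ W / a := by
      rw [le_div_iff₀ ha0]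
      have h1 : y * (a : ℝ) ≤ g * a := mul_le_mul_of_nonneg_right hyg' ha0.le
      have h2 : g * (a : ℝ) = a * g := mul_comm _ _
      linarith
    have huP : usage y t j k₁ (k₁ + a) = (W / a) / (1 - W / a) := by
      have hmax : y ^ 2 + (1 - y) * (W / a) ≤ W / a := by
        have h := mul_nonpos_of_nonneg_of_nonpos hy0.le (sub_nonpos.2 hyρP)
        have e : y ^ 2 + (1 - y) * (W / a) = W / a + y * (y - W / a) := by ring
        rw [e]; linarith
      simp only [usage, gateOf, if_neg hPng, pairGate]
      rw [hρP, max_eq_left hmax]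
    set capP : ℝ := B * (1 - W / a) / (W / a) with hcapPdef
    have hcapP0 : 0 ≤ capP := div_nonneg (mul_nonneg hB0 (by linarith)) hρP0.le
    have hane : (a : ℝ) ≠ 0 := ne_of_gt ha0
    have hWne : W ≠ 0 := ne_of_gt hW0
    have hcapP_eq : capP * W = B * (a - W) := by rw [hcapPdef]; field_simp
    have hsatP : usage y t j k₁ (k₁ + a) * capP = B := by
      have h1 : 1 - W / a ≠ 0 := ne_of_gt (by linarith)
      have h2 : W / a ≠ 0 := ne_of_gt hρP0
      rw [huP, hcapPdef, div_mul_div_comm, mul_comm (1 - W / a) (W / a), ← mul_assoc]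
      rw [mul_div_mul_right _ _ h1, mul_comm (W / a) B, mul_div_assoc, div_self h2, mul_one]
    have hSP0 : 0 ≤ t * capP + (t - ((k₁ : ℝ) + a)) * B := by
      -- `= k₁ B (2P − t)/W ≥ 0`
      have e : (t * capP + (t - ((k₁ : ℝ) + a)) * B) * W = (k₁ : ℝ) * B * (2 * ((k₁ : ℝ) + a) - t) := by
        have : t * capP * W = t * (B * (a - W)) := by rw [mul_assoc, hcapP_eq]
        rw [add_mul, this, hWdef]; ring
      have hpos : 0 ≤ (k₁ : ℝ) * B * (2 * ((k₁ : ℝ) + a) - t) := mul_nonneg (mul_nonneg (by linarith) hB0) (by linarith)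
      by_contra hneg
      have : (t * capP + (t - ((k₁ : ℝ) + a)) * B) * W < 0 := mul_neg_of_neg_of_pos (not_le.1 hneg) hW0
      linarith
    by_cases hKc : t < (k₁ : ℝ) + k₂
    · -- the top is open to `k₁`
      set ρ : ℝ := W / ((k₂ : ℝ) - k₁) with hρ
      have hρ0 : 0 < ρ := div_pos hW0 hd
      by_cases hKheavy : y * ((k₂ : ℝ) - k₁) ≤ W
      · -- heavy top
        have hρ1 : ρ < 1 := by rw [hρ, div_lt_one hd, hWdef]; linarith
        have hyρ : y ≤ ρ := by rw [hρ, le_div_iff₀ hd]; exact hKheavy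
        have huK : usage y t j k₁ k₂ = ρ / (1 - ρ) := by
          have hmax : y ^ 2 + (1 - y) * ρ ≤ ρ := by
            have h := mul_nonpos_of_nonneg_of_nonpos hy0.le (sub_nonpos.2 hyρ)
            have e : y ^ 2 + (1 - y) * ρ = ρ + y * (y - ρ) := by ring
            rw [e]; linarith
          simp only [usage, gateOf, if_neg hKng, pairGate]
          rw [← hWdef, ← hρ, max_eq_left hmax]
        set capK : ℝ := C * (1 - ρ) / ρ with hcapK
        have hcapK0 : 0 ≤ capK := div_nonneg (mul_nonneg hC0 (sub_nonneg.2 hρ1.le)) hρ0.le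
        have hcapK_eq : capK * W = C * ((k₂ : ℝ) + k₁ - t) := by
          have hdne : (k₂ : ℝ) - k₁ ≠ 0 := ne_of_gt hd
          have hW2 : t - 2 * (k₁ : ℝ) ≠ 0 := by rw [← hWdef]; exact hWne
          have e1 : capK * W = C * (1 - ρ) / ρ * (t - 2 * (k₁ : ℝ)) := by rw [hcapK, hWdef]
          rw [e1, hρ, hWdef]
          field_simp
          ring
        have hρne : 1 - ρ ≠ 0 := ne_of_gt (by linarith)
        have hρne0 : ρ ≠ 0 := ne_of_gt hρ0
        have hsatK : usage y t j k₁ k₂ * capK = C := by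
          rw [huK, hcapK, div_mul_div_comm, mul_comm (1 - ρ) ρ, ← mul_assoc]
          rw [mul_div_mul_right _ _ hρne, mul_comm ρ C, mul_div_assoc, div_self hρne0, mul_one]
        have huK0 : 0 ≤ usage y t j k₁ k₂ := by rw [huK]; exact div_nonneg hρ0.le (by linarith)
        by_cases hfitK : A - capP ≤ capK
        · have huseK : usage y t j k₁ k₂ * (A - capP) ≤ C := by
            have := mul_le_mul_of_nonneg_left hfitK huK0
            linarith [hsatK]
          by_cases hAP : A ≤ capP
          · have huseP : usage y t j k₁ (k₁ + a) * A ≤ B := by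
              have huP0 : 0 ≤ usage y t j k₁ (k₁ + a) := by rw [huP]; exact div_nonneg hρP0.le (by linarith)
              have := mul_le_mul_of_nonneg_left hAP huP0
              linarith [hsatP]
            exact mixLawQ_decAtT_of_midsAbsorb y z g S lam a j M k₁ k₂ A 0 hy0 hy1 hz0 hz1 hg1 hyg ha hta hk hk₂M hlam0 hlam1 hmean
              hk₁ hk₁j hk₁low hPabs hKabs hG hA0 le_rfl (by ring) (fun _ => ⟨hPj, hPcomp⟩) (fun h => absurd h (lt_irrefl _))
              huseP (by rw [mul_zero]; exact hC0)
          · exact mixLawQ_decAtT_of_midsAbsorb y z g S lam a j M k₁ k₂ capP (A - capP) hy0 hy1 hz0 hz1 hg1 hyg ha hta hk hk₂M hlam0 hlam1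
              hmean hk₁ hk₁j hk₁low hPabs hKabs hG hcapP0 (by linarith [not_le.1 hAP]) (by ring) (fun _ => ⟨hPj, hPcomp⟩)
              (fun _ => ⟨hKj, hKc⟩) (le_of_eq hsatP) huseK
        · -- both saturated: I2o
          have hI2s := twinOpen_I2_open z g S t lam (k₁ : ℝ) (k₂ : ℝ) (a : ℝ) hz0 hz1 hg0 hg1 hlam0 hlam1 hk₁r ha1 hmean ht hWa hKmid hk₁k₂
          have hI2 : A * W ≤ B * (2 * ((k₁ : ℝ) + a) - t) + C * (2 * (k₂ : ℝ) - t) := by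
            have h := mul_le_mul_of_nonneg_left hI2s h1z.le
            have eC : (1 - z) * (lam * (1 - g) * (2 * (k₂ : ℝ) - t)) = C * (2 * (k₂ : ℝ) - t) := by rw [hC]; ring
            linarith [eAB, eC]
          have hE : y * (z + (A - capP - capK)) ≤ (1 - y) * D :=
            twinOpen_beta_open t y k₁ k₂ a A B C D z capP capK W hy0 ht0 (by linarith) hWdef hW0 htz hyG hD0 hcapP_eq hcapK_eq hI2
          refine mixLawQ_decAtT_of_routing y z g S lam a j M k₁ k₂ capP capK (A - capP - capK) hy0 hy1 hz0 hz1 hg1 hyg ha hta hk hk₂M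
            hlam0 hlam1 hmean hk₁ hk₁j hk₁low hPabs hKabs hG hcapP0 hcapK0 (by linarith [not_le.1 hfitK]) (by ring)
            (fun _ => Or.inr hPcomp) (fun _ => Or.inr hKc) (le_of_eq hsatP) (le_of_eq hsatK) (hcapG_of _ hE) ?_
          rw [hsatP, sub_self, mul_zero, hsatK, sub_self, mul_zero, zero_add, zero_add]
          exact hfinal _ hE
      · -- light top
        have hKlight : W < y * ((k₂ : ℝ) - k₁) := not_le.1 hKheavy
        have hρy : ρ < y := by rw [hρ, div_lt_iff₀ hd]; exact hKlight
        set γ : ℝ := y ^ 2 + (1 - y) * ρ with hγ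
        have hγ0 : 0 < γ := by
          have h1 : 0 < (1 - y) * ρ := mul_pos h1y hρ0
          have h2 : 0 ≤ y ^ 2 := sq_nonneg y
          rw [hγ]; linarith
        have hγ1 : γ < 1 := by
          have h1 := mul_lt_mul_of_pos_left hρy h1y
          have e : y ^ 2 + (1 - y) * y = y := by ring
          rw [hγ]; linarith
        have huK : usage y t j k₁ k₂ = γ / (1 - γ) := by
          have hmax : ρ ≤ y ^ 2 + (1 - y) * ρ := by
            have h1 := mul_le_mul_of_nonneg_left hρy.le hy0.le
            have e1 : y ^ 2 = y * y := sq y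
            have e2 : (1 - y) * ρ = ρ - y * ρ := by ring
            linarith
          simp only [usage, gateOf, if_neg hKng, pairGate]
          rw [← hWdef, ← hρ, max_eq_right hmax]
        set capK : ℝ := C * (1 - γ) / γ with hcapK
        have hcapK0 : 0 ≤ capK := div_nonneg (mul_nonneg hC0 (sub_nonneg.2 hγ1.le)) hγ0.le
        have hγne : 1 - γ ≠ 0 := ne_of_gt (by linarith)
        have hγne0 : γ ≠ 0 := ne_of_gt hγ0
        have hsatK : usage y t j k₁ k₂ * capK = C := by
          rw [huK, hcapK, div_mul_div_comm, mul_comm (1 - γ) γ, ← mul_assoc]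
          rw [mul_div_mul_right _ _ hγne, mul_comm γ C, mul_div_assoc, div_self hγne0, mul_one]
        have huK0 : 0 ≤ usage y t j k₁ k₂ := by rw [huK]; exact div_nonneg hγ0.le (by linarith)
        by_cases hfitK : A - capP ≤ capK
        · have huseK : usage y t j k₁ k₂ * (A - capP) ≤ C := by
            have := mul_le_mul_of_nonneg_left hfitK huK0
            linarith [hsatK]
          by_cases hAP : A ≤ capP
          · have huseP : usage y t j k₁ (k₁ + a) * A ≤ B := by
              have huP0 : 0 ≤ usage y t j k₁ (k₁ + a) := by rw [huP]; exact div_nonneg hρP0.le (by linarith)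
              have := mul_le_mul_of_nonneg_left hAP huP0
              linarith [hsatP]
            exact mixLawQ_decAtT_of_midsAbsorb y z g S lam a j M k₁ k₂ A 0 hy0 hy1 hz0 hz1 hg1 hyg ha hta hk hk₂M hlam0 hlam1 hmean
              hk₁ hk₁j hk₁low hPabs hKabs hG hA0 le_rfl (by ring) (fun _ => ⟨hPj, hPcomp⟩) (fun h => absurd h (lt_irrefl _))
              huseP (by rw [mul_zero]; exact hC0)
          · exact mixLawQ_decAtT_of_midsAbsorb y z g S lam a j M k₁ k₂ capP (A - capP) hy0 hy1 hz0 hz1 hg1 hyg ha hta hk hk₂M hlam0 hlam1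
              hmean hk₁ hk₁j hk₁low hPabs hKabs hG hcapP0 (by linarith [not_le.1 hAP]) (by ring) (fun _ => ⟨hPj, hPcomp⟩)
              (fun _ => ⟨hKj, hKc⟩) (le_of_eq hsatP) huseK
        · -- both saturated: the light surplus pays
          have hL := mixLawQ_light_gate z S t lam (k₁ : ℝ) (k₂ : ℝ) (a : ℝ) y g hz0 hz1 hy0 hy1 hg0.le (by linarith) hk₁k₂ (by linarith)
            hmean ht hyK (by rw [← hWdef]; exact hKlight) h2k
          have hL' : S * γ ≤ (1 - z) * lam * t := by rw [hγ, hρ, hWdef]; exact hL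
          have hmeanK : (1 - z) * lam * (k₂ : ℝ) = S - (1 - z) * k₁ + (1 - z) * lam * k₁ := by rw [← hmean]; ring
          have hSK := mixLawQ_surplus_light_ge z S t lam (k₁ : ℝ) (k₂ : ℝ) g γ hg1 hγ0 hL' hmeanK
          have hSKeq : t * capK + (t - (k₂ : ℝ)) * C = ((1 - z) * lam * (1 - g)) * (t / γ - k₂) := by
            rw [hcapK, hC]; field_simp; ring
          have hE : y * (z + (A - capP - capK)) ≤ (1 - y) * D := by
            refine mixLawQ_offer_of_surplus t y k₁ k₂ a A B C D z capP capK (t * capP + (t - ((k₁ : ℝ) + a)) * B)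
              (t * capK + (t - (k₂ : ℝ)) * C) hy0 ht0 htz hyG hD0 rfl rfl ?_
            have : (k₁ : ℝ) * A ≤ t * capK + (t - (k₂ : ℝ)) * C := by rw [hSKeq, hA]; exact hSK
            linarith [hSP0]
          refine mixLawQ_decAtT_of_routing y z g S lam a j M k₁ k₂ capP capK (A - capP - capK) hy0 hy1 hz0 hz1 hg1 hyg ha hta hk hk₂M
            hlam0 hlam1 hmean hk₁ hk₁j hk₁low hPabs hKabs hG hcapP0 hcapK0 (by linarith [not_le.1 hfitK]) (by ring)
            (fun _ => Or.inr hPcomp) (fun _ => Or.inr hKc) (le_of_eq hsatP) (le_of_eq hsatK) (hcapG_of _ hE) ?_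
          rw [hsatP, sub_self, mul_zero, hsatK, sub_self, mul_zero, zero_add, zero_add]
          exact hfinal _ hE
    · -- the top is CLOSED to `k₁` (then `K ≤ t − k₁ < t`): I2c
      have hKc' : (k₁ : ℝ) + k₂ ≤ t := not_lt.1 hKc
      have hI2s := twinOpen_I2_closed z g S t lam (k₁ : ℝ) (k₂ : ℝ) (a : ℝ) hz0 hz1 hg0 hg1 hlam0 hlam1 hk₁r ha1 hmean ht hWa hKc' hk₁k₂
      have hI2 : A * W ≤ B * (2 * ((k₁ : ℝ) + a) - t) + C * W := by
        have h := mul_le_mul_of_nonneg_left hI2s h1z.le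
        have eC : (1 - z) * (lam * (1 - g) * (t - 2 * (k₁ : ℝ))) = C * W := by rw [hC, hWdef]; ring
        linarith [eAB, eC]
      have hE : y * (z + (A - capP)) ≤ (1 - y) * D :=
        twinOpen_beta_closed t y k₁ k₂ a A B C D z capP W hy0 ht0 (by linarith) hWdef hW0 htz hyG hC0 hD0 hKc' hcapP_eq hI2
      refine mixLawQ_decAtT_of_routing y z g S lam a j M k₁ k₂ capP 0 (A - capP) hy0 hy1 hz0 hz1 hg1 hyg ha hta hk hk₂M hlam0 hlam1
        hmean hk₁ hk₁j hk₁low hPabs hKabs hG hcapP0 le_rfl (by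
          have h1 : capP * W ≤ A * W := by
            rw [hcapP_eq, hA, hB]
            have hc : 0 ≤ (1 - z) * (1 - lam) := mul_nonneg h1z.le (by linarith)
            have h := mul_le_mul_of_nonneg_left hWg'.le hc
            have e1 : (1 - z) * (1 - lam) * g * ((a : ℝ) - W) = (1 - z) * (1 - lam) * ((a : ℝ) * g) - (1 - z) * (1 - lam) * W * g := by ring
            have e2 : (1 - z) * (1 - lam) * (1 - g) * W = (1 - z) * (1 - lam) * W - (1 - z) * (1 - lam) * W * g := by ring
            rw [e1, e2]
            linarith [h]
          linarith [le_of_mul_le_mul_right h1 hW0]) (by ring)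
        (fun _ => Or.inr hPcomp) (fun h => absurd h (lt_irrefl _)) (le_of_eq hsatP) (by rw [mul_zero]; exact hC0) (hcapG_of _ hE) ?_
      rw [hsatP, sub_self, mul_zero, mul_zero, sub_zero, if_neg hKng, if_neg (by linarith : ¬ (t < (k₂ : ℝ))), zero_mul, zero_add,
        zero_add]
      exact hfinal _ hE

/-- **`GatedSliceMixLaw'` with θ = 0 in the twin-above-`t` classes.** [this work] -/
theorem gatedSliceMixLaw'_twinAbove (y z g S lam : ℝ) (a j M h k₁ k₂ : ℕ)
    (hy0 : 0 < y) (hy1 : y < 1) (hz0 : 0 ≤ z) (hz1 : z < 1) (hg1 : g ≤ 1) (hyg : y ≤ (1 - z) * g) (ha : 1 ≤ a)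
    (hta : y * (M : ℝ) ≤ S) (hk : k₁ ≤ k₂) (hk₂M : k₂ ≤ M) (hlam0 : 0 ≤ lam) (hlam1 : lam ≤ 1)
    (hmean : (1 - z) * ((k₁ : ℝ) + ((k₂ : ℝ) - k₁) * lam) = S)
    (hk₁ : 1 ≤ k₁) (hk₁j : k₁ ≤ j) (hk₁low : 2 * (k₁ : ℝ) < S + (a : ℝ) * g * (1 - z))
    (hPj : k₁ + a ≤ j) (hPopen : S + (a : ℝ) * g * (1 - z) < (k₁ : ℝ) + a)
    (hKj : k₂ ≤ j) (hKmid : S + (a : ℝ) * g * (1 - z) ≤ 2 * (k₂ : ℝ))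
    (hG : j + 1 ≤ k₂ + a) :
    ∃ θ : ℝ, 0 ≤ θ ∧ θ < 1 ∧
      DECAtT y (S + (a : ℝ) * g * (1 - z)) j (M + a)
        (fun p => θ * weakMidLaw S g h a p
          + (1 - θ) * (z * (if p = 0 then (1 : ℝ) else 0) + (1 - z) * slice (fun q => TP[k₁, k₂, lam, q]) a g p)) := by
  refine ⟨0, le_rfl, zero_lt_one, ?_⟩
  refine decAtT_congr (fun p => ?_)
    (mixLawQ_decAtT_twinAbove y z g S lam a j M k₁ k₂ hy0 hy1 hz0 hz1 hg1 hyg ha hta hk hk₂M hlam0 hlam1 hmean hk₁ hk₁j hk₁low hPj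
      hPopen hKj hKmid hG)
  ring

end LawDec

end Quant

end Summit.CriticalPhenomena.PercolationContinuityZ3.Theorems
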